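import Literature.Analysis.FluidPDE.BesovDuhamelBlocks
import Literature.Analysis.FluidPDE.KatoPicardLp
import HarnessLib

/-!
# The `ℓ¹ ∩ ℓ^∞` block profile of the Navier–Stokes Duhamel term of a Kato-class field

Analysis/FluidPDE proof file (no definitions, no named facts). Third layer (after
`OseenKernelBlocks.lean` and `BesovDuhamelBlocks.lean`) of the Besov regularity of the Duhamel term
`B(u,u)(t) = ∫₀ᵗ e^{(t-s)Δ}ℙ∇·(u ⊗ u)(s) ds` (`kochTataruBilinear u u t`, unit viscosity) of a field
in Kato's class `‖u(s)‖_{L^p} ≤ a s^{-(1-3/p)/2}`, `|u(s)(x)| ≤ b s^{-1/2}` on `(0,T)`, `3 < p < ∞`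
(item "Duhamel term in `C((0,T); Ḃ^{-1+3/p}_{p,1})`" of
`Literature.Analysis.FluidPDE.exists_isBesovMildSolutionOn`, Bahouri–Chemin–Danchin 2011,
Thm. 5.40; Gallagher–Koch–Planchon 2016, App. B):

* `exists_tsum_min_rpow_rpow_neg_le` — the dyadic sum `∑_{j∈ℤ} min((2^jt)^a, (2^jt)^{-b}) ≤ K`
  uniformly in `t > 0` (`a, b > 0`; two geometric tails);
* `exists_lintegral_oseenKernelBlockMajorant_le` — the `L¹` size of the scalar majorant
  `m_j(σ) = ∑_{k,l} ‖Δ̇_j K(σ,·)[e_k,e_l]‖` of the blocked Oseen kernel: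
  `∫ m_j(σ) ≤ C min(2^{jθ}σ^{(θ-1)/2}, σ^{-1/2})`, `0 ≤ θ < 1` (the vanishing-mean gain
  `exists_lintegral_enorm_oseenKernelBlock_le_low`, and `‖Δ̇_j f‖₁ ≤ ‖K₀‖₁‖f‖₁` with Koch–Tataru's
  (14), `‖K(σ,·)[a,b]‖₁ ≤ Cσ^{-1/2}‖a‖‖b‖`);
* `exists_lpBlockWeight_kochTataruBilinear_le` — **the profile**: with `s_p = -1 + 3/p` and
  `y = 2^j √t`,
  `2^{js_p} ‖Δ̇_j B(u,u)(t)‖_{L^p} ≤ C a b min(y^{3/(2p)}, y^{-(1-3/p)})` for `t ∈ (0,T)`, `j ∈ ℤ`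
  (the block form of Kato's estimate `eLpNorm_blockFn_kochTataruBilinear_le` with the weight
  `N(s) = ‖u(s)‖_p‖u(s)‖_∞ ≤ ab s^{-(1-3/(2p))}`, the majorant bound with `θ = 1 - 3/(2p)`, and the
  Beta integrals `∫₀ᵗ (t-s)^{-α}s^{-β} ds = B t^{1-α-β}`; GKP 2016, App. B: an `ℓ¹ ∩ ℓ^∞` profile
  in `4^j t`, uniformly in `t`, because `3/(2p) > 0` and `1 - 3/p > 0`);
* `exists_lpBlockWeight_oseenDuhamel_one_le` — the same for the short Duhamel pieces
  `B¹_{t₁}(u,u)(t) = ∫_{t₁}^t …` (`oseenDuhamel 1 t₁ u u t`, `0 < t₁ < t ≤ T`):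
  `2^{js_p} ‖Δ̇_j B¹_{t₁}(u,u)(t)‖_{L^p} ≤ C a b t₁^{-γ} h^{γ} min(z^{3/(2p)}, z^{-(1-3/p)})`,
  `h = t - t₁`, `z = 2^j √h`, `γ = 1 - 3/(2p)` (the source of the time continuity).

## References

* H. Bahouri, J.-Y. Chemin, R. Danchin, *Fourier Analysis and Nonlinear PDE* (2011), Thm. 5.40
  (proof), Lemma 2.4. [BahouriCheminDanchin2011]
* I. Gallagher, G. S. Koch, F. Planchon, Comm. Math. Phys. 343 (2016) = arXiv:1407.4156, App. B.
  [GKP2016]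
* T. Kato, Math. Z. 187 (1984), (2.3)–(2.5). [Kato1984]
-/

noncomputable section

open MeasureTheory Set Function Filter
open _root_.Topology
open scoped ENNReal NNReal RealInnerProductSpace

namespace Literature.Analysis.FluidPDE

open FunctionSpaces (blockFn blockKernel)

/-! ### A dyadic sum over `ℤ` -/

section Dyadic

/-- **The dyadic sum of a two-sided power profile**: for `a, b > 0` there is `K < ∞` with
`∑_{j ∈ ℤ} min((2^j t)^a, (2^j t)^{-b}) ≤ K` for every `t > 0` (with `2^{j₀} t ∈ [1/2, 1)` the
terms `j ≥ j₀` are `≤ 2^b 2^{-(j-j₀)b}` and the terms `j < j₀` are `≤ 2^{-(j₀-j)a}`; both tails are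
geometric). [folklore] -/
theorem exists_tsum_min_rpow_rpow_neg_le {a b : ℝ} (ha : 0 < a) (hb : 0 < b) :
    ∃ K : ℝ≥0∞, K ≠ ⊤ ∧ ∀ t : ℝ, 0 < t →
      ∑' j : ℤ, ENNReal.ofReal (min (((2 : ℝ) ^ j * t) ^ a) (((2 : ℝ) ^ j * t) ^ (-b))) ≤ K := by
  -- the function and its two bounds
  set h : ℝ → ℝ := fun x => min (x ^ a) (x ^ (-b)) with hh
  have hb1 : ∀ x, 0 < x → h x ≤ x ^ a := fun x _ => min_le_left _ _
  have hb2 : ∀ x, 0 < x → h x ≤ x ^ (-b) := fun x _ => min_le_right _ _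
  set ρ₁ : ℝ≥0∞ := ENNReal.ofReal ((2 : ℝ) ^ (-b)) with hρ₁
  have hρ₁1 : ρ₁ < 1 := by
    rw [hρ₁, ENNReal.ofReal_lt_one]
    exact Real.rpow_lt_one_of_one_lt_of_neg one_lt_two (neg_neg_of_pos hb)
  set ρ₂ : ℝ≥0∞ := ENNReal.ofReal ((2 : ℝ) ^ (-a)) with hρ₂
  have hρ₂1 : ρ₂ < 1 := by
    rw [hρ₂, ENNReal.ofReal_lt_one]
    exact Real.rpow_lt_one_of_one_lt_of_neg one_lt_two (neg_neg_of_pos ha)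
  set A : ℝ≥0∞ := ENNReal.ofReal ((2 : ℝ) ^ b) with hA
  refine ⟨A * (1 - ρ₁)⁻¹ + (1 - ρ₂)⁻¹, ?_, fun t ht => ?_⟩
  · have h1 : (1 - ρ₁)⁻¹ ≠ ⊤ := ENNReal.inv_ne_top.2 (tsub_pos_of_lt hρ₁1).ne'
    have h2 : (1 - ρ₂)⁻¹ ≠ ⊤ := ENNReal.inv_ne_top.2 (tsub_pos_of_lt hρ₂1).ne'
    exact ENNReal.add_ne_top.2 ⟨ENNReal.mul_ne_top ENNReal.ofReal_ne_top h1, h2⟩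
  -- choose `j₀` with `2^{j₀} t ∈ [1/2, 1)`
  obtain ⟨m, hm⟩ := exists_mem_Ico_zpow ht one_lt_two
  set j₀ : ℤ := -m - 1 with hj₀
  set x₀ : ℝ := (2 : ℝ) ^ j₀ * t with hx₀
  have hx₀1 : x₀ < 1 := by
    have := hm.2
    rw [hx₀, hj₀, show -m - 1 = -(m + 1) by ring, zpow_neg, inv_mul_lt_iff₀ (zpow_pos two_pos _)]
    simpa using this
  have hx₀2 : 2⁻¹ ≤ x₀ := by
    have := hm.1
    rw [hx₀, hj₀, show -m - 1 = -(m + 1) by ring, zpow_neg, le_inv_mul_iff₀ (zpow_pos two_pos _),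
      zpow_add_one₀ (two_ne_zero' ℝ)]
    linarith
  have hx₀0 : 0 < x₀ := lt_of_lt_of_le (by norm_num) hx₀2
  -- reindex `j = k + j₀`
  have hshift : ∑' j : ℤ, ENNReal.ofReal (h ((2 : ℝ) ^ j * t)) =
      ∑' k : ℤ, ENNReal.ofReal (h ((2 : ℝ) ^ k * x₀)) := by
    rw [← (Equiv.addRight j₀).tsum_eq]
    congr 1
    funext k
    simp only [Equiv.coe_addRight, hx₀]
    rw [zpow_add₀ (two_ne_zero' ℝ), mul_assoc]
  -- bounds on the two tails
  have hpos : ∀ k : ℕ, ENNReal.ofReal (h ((2 : ℝ) ^ (k : ℤ) * x₀)) ≤ A * ρ₁ ^ k := by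
    intro k
    have hx : 0 < (2 : ℝ) ^ (k : ℤ) * x₀ := by positivity
    rw [hA, hρ₁, ← ENNReal.ofReal_pow (Real.rpow_nonneg zero_le_two _),
      ← ENNReal.ofReal_mul (by positivity)]
    refine ENNReal.ofReal_le_ofReal ((hb2 _ hx).trans ?_)
    rw [← Real.rpow_natCast, ← Real.rpow_mul zero_le_two, zpow_natCast]
    have hxlow : (2 : ℝ) ^ k * 2⁻¹ ≤ (2 : ℝ) ^ k * x₀ := by gcongr
    have hk2 : 0 < (2 : ℝ) ^ k * 2⁻¹ := by positivity
    calc ((2 : ℝ) ^ k * x₀) ^ (-b) ≤ ((2 : ℝ) ^ k * 2⁻¹) ^ (-b) :=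
          Real.rpow_le_rpow_of_nonpos hk2 hxlow (neg_nonpos.2 hb.le)
      _ = (2 : ℝ) ^ b * (2 : ℝ) ^ (-b * k) := by
          rw [Real.mul_rpow (by positivity) (by norm_num), Real.inv_rpow zero_le_two,
            ← Real.rpow_neg zero_le_two, neg_neg, ← Real.rpow_natCast, ← Real.rpow_mul zero_le_two]
          ring_nf
  have hneg : ∀ k : ℕ, ENNReal.ofReal (h ((2 : ℝ) ^ (-((k : ℤ) + 1)) * x₀)) ≤ ρ₂ ^ k := by
    intro k
    have hx : 0 < (2 : ℝ) ^ (-((k : ℤ) + 1)) * x₀ := by positivity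
    rw [hρ₂, ← ENNReal.ofReal_pow (Real.rpow_nonneg zero_le_two _)]
    refine ENNReal.ofReal_le_ofReal ((hb1 _ hx).trans ?_)
    rw [← Real.rpow_natCast, ← Real.rpow_mul zero_le_two]
    have hxle : (2 : ℝ) ^ (-((k : ℤ) + 1)) * x₀ ≤ (2 : ℝ) ^ (-((k : ℤ) + 1)) :=
      mul_le_of_le_one_right (zpow_nonneg zero_le_two _) hx₀1.le
    calc ((2 : ℝ) ^ (-((k : ℤ) + 1)) * x₀) ^ a ≤ ((2 : ℝ) ^ (-((k : ℤ) + 1))) ^ a :=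
          Real.rpow_le_rpow hx.le hxle ha.le
      _ = (2 : ℝ) ^ (-a * (k + 1)) := by
          rw [← Real.rpow_intCast, ← Real.rpow_mul zero_le_two]
          push_cast
          ring_nf
      _ ≤ (2 : ℝ) ^ (-a * k) := by
          refine Real.rpow_le_rpow_of_exponent_le one_le_two ?_
          nlinarith
  -- sum the two geometric tails
  rw [show (fun j : ℤ => ENNReal.ofReal (min (((2 : ℝ) ^ j * t) ^ a) (((2 : ℝ) ^ j * t) ^ (-b)))) =
      fun j : ℤ => ENNReal.ofReal (h ((2 : ℝ) ^ j * t)) from rfl, hshift,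
    tsum_of_nat_of_neg_add_one ENNReal.summable ENNReal.summable]
  gcongr
  · calc ∑' k : ℕ, ENNReal.ofReal (h ((2 : ℝ) ^ (k : ℤ) * x₀)) ≤ ∑' k : ℕ, A * ρ₁ ^ k :=
          ENNReal.tsum_le_tsum hpos
      _ = A * (1 - ρ₁)⁻¹ := by rw [ENNReal.tsum_mul_left, ENNReal.tsum_geometric]
  · calc ∑' k : ℕ, ENNReal.ofReal (h ((2 : ℝ) ^ (-((k : ℤ) + 1)) * x₀)) ≤ ∑' k : ℕ, ρ₂ ^ k :=
          ENNReal.tsum_le_tsum hneg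
      _ = (1 - ρ₂)⁻¹ := ENNReal.tsum_geometric ρ₂

/-- `min (c₁ x) (c₂ z) ≤ max c₁ c₂ · min x z` for nonnegative reals. [folklore] -/
theorem min_mul_mul_le_max_mul_min {c₁ c₂ x z : ℝ} (hx : 0 ≤ x) (hz : 0 ≤ z) :
    min (c₁ * x) (c₂ * z) ≤ max c₁ c₂ * min x z := by
  rcases le_total x z with hxz | hzx
  · rw [min_eq_left hxz]
    exact (min_le_left _ _).trans (mul_le_mul_of_nonneg_right (le_max_left _ _) hx)
  · rw [min_eq_right hzx]
    exact (min_le_right _ _).trans (mul_le_mul_of_nonneg_right (le_max_right _ _) hz)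

/-- `2^{jc} t^{c/2} = (2^j √t)^c` for `t ≥ 0`. [folklore] -/
theorem two_rpow_mul_rpow_half {t : ℝ} (ht : 0 ≤ t) (j : ℤ) (c : ℝ) :
    (2 : ℝ) ^ ((j : ℝ) * c) * t ^ (c / 2) = ((2 : ℝ) ^ j * Real.sqrt t) ^ c := by
  rw [Real.mul_rpow (zpow_nonneg zero_le_two _) (Real.sqrt_nonneg _), Real.sqrt_eq_rpow,
    ← Real.rpow_mul ht, Real.rpow_mul zero_le_two, Real.rpow_intCast]
  congr 1
  congr 1
  ring

/-- `ofReal (2^e) = 2^e` in `ℝ≥0∞` (real exponent). [folklore] -/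
theorem ofReal_two_rpow (e : ℝ) : ENNReal.ofReal ((2 : ℝ) ^ e) = (2 : ℝ≥0∞) ^ e := by
  rw [← ENNReal.ofReal_rpow_of_pos two_pos, ENNReal.ofReal_ofNat]

end Dyadic

/-! ### The `L¹` size of the scalar majorant of the blocked kernel -/

section Majorant

variable {E : Type*} [NormedAddCommGroup E] [InnerProductSpace ℝ E] [FiniteDimensional ℝ E]
  [MeasurableSpace E] [BorelSpace E]

/-- **The `L¹` size of the scalar majorant** `m_j(σ) = ∑_{k,l} ‖Δ̇_j K(σ,·)[e_k,e_l]‖` of the blocked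
Oseen kernel: for `0 ≤ θ < 1` there is `C` with
`∫ m_j(σ) ≤ C min(2^{jθ} σ^{(θ-1)/2}, σ^{-1/2})` for all `j ∈ ℤ`, `σ > 0` — the low-frequency gain
`exists_lintegral_enorm_oseenKernelBlock_le_low` and the plain bound `‖Δ̇_j f‖₁ ≤ ‖K₀‖₁‖f‖₁`,
`‖K(σ,·)[a,b]‖₁ ≤ Cσ^{-1/2}‖a‖‖b‖` (Koch–Tataru's (14); the exponentially small high-frequency
bound is not needed here). [cite: GKP2016, App. B] -/
theorem exists_lintegral_oseenKernelBlockMajorant_le {θ : ℝ} (hθ0 : 0 ≤ θ) (hθ1 : θ < 1) :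
    ∃ C : ℝ, 0 ≤ C ∧ ∀ (j : ℤ) {σ : ℝ}, 0 < σ →
      ∫⁻ y, ‖∑ k, ∑ l, ‖blockFn j (fun w => oseenKernel σ w (stdOrthonormalBasis ℝ E k)
          (stdOrthonormalBasis ℝ E l)) y‖‖ₑ ≤
        ENNReal.ofReal (C * min ((2 : ℝ) ^ ((j : ℝ) * θ) * σ ^ ((θ - 1) / 2))
          (σ ^ (-(1 / 2 : ℝ)))) := by
  set e := stdOrthonormalBasis ℝ E with he
  obtain ⟨CL, hCL, hL⟩ := exists_lintegral_enorm_oseenKernelBlock_le_low (E := E) hθ0 hθ1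
  obtain ⟨CK, hCK, hK⟩ := exists_lintegral_enorm_oseenKernel_le (E := E)
  have hK1top := lintegral_enorm_blockKernel_lt_top (E := E) 0
  set K₁ : ℝ := (∫⁻ y, ‖blockKernel E 0 y‖ₑ).toReal with hK₁
  have hK₁0 : 0 ≤ K₁ := ENNReal.toReal_nonneg
  have hK₁eq : ENNReal.ofReal K₁ = ∫⁻ y, ‖blockKernel E 0 y‖ₑ := ENNReal.ofReal_toReal hK1top.ne
  set C₀ : ℝ := max CL (K₁ * CK) with hC₀
  have hC₀0 : 0 ≤ C₀ := le_max_of_le_left hCL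
  refine ⟨(Module.finrank ℝ E) * (Module.finrank ℝ E) * C₀, by positivity, fun j {σ} hσ => ?_⟩
  haveI h11 : Fact ((1 : ℝ≥0∞) ≤ 1) := ⟨le_rfl⟩
  set L : ℝ := (2 : ℝ) ^ ((j : ℝ) * θ) * σ ^ ((θ - 1) / 2) with hLdef
  set H : ℝ := σ ^ (-(1 / 2 : ℝ)) with hHdef
  have hL0 : 0 ≤ L := by positivity
  have hH0 : 0 ≤ H := Real.rpow_nonneg hσ.le _
  have hm : ∀ k l, AEStronglyMeasurable (blockFn j (fun w => oseenKernel σ w (e k) (e l))) volume :=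
    fun k l => FunctionSpaces.aestronglyMeasurable_blockFn j
      (measurable_oseenKernel_left σ _ _).aestronglyMeasurable
  -- each term obeys both bounds
  have hterm : ∀ k l, ∫⁻ z, ‖blockFn j (fun w => oseenKernel σ w (e k) (e l)) z‖ₑ ≤
      ENNReal.ofReal (C₀ * min L H) := by
    intro k l
    have hlow : ∫⁻ z, ‖blockFn j (fun w => oseenKernel σ w (e k) (e l)) z‖ₑ ≤
        ENNReal.ofReal (CL * L) := by
      refine (hL j hσ (e k) (e l)).trans (le_of_eq ?_)
      rw [e.norm_eq_one, e.norm_eq_one, mul_one, mul_one, hLdef, ← mul_assoc]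
    have hhigh : ∫⁻ z, ‖blockFn j (fun w => oseenKernel σ w (e k) (e l)) z‖ₑ ≤
        ENNReal.ofReal (K₁ * CK * H) := by
      have hf : AEStronglyMeasurable (fun w => oseenKernel σ w (e k) (e l)) volume :=
        (measurable_oseenKernel_left σ _ _).aestronglyMeasurable
      have h1 := FunctionSpaces.eLpNorm_blockFn_le j hf (p := 1) le_rfl
      rw [eLpNorm_one_eq_lintegral_enorm, eLpNorm_one_eq_lintegral_enorm,
        lintegral_enorm_blockKernel j] at h1
      refine h1.trans ?_
      have h2 := (hK hσ (e k) (e l)).2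
      rw [e.enorm_eq_one, e.enorm_eq_one, mul_one, mul_one] at h2
      calc (∫⁻ y, ‖blockKernel E 0 y‖ₑ) * ∫⁻ z, ‖oseenKernel σ z (e k) (e l)‖ₑ
          ≤ ENNReal.ofReal K₁ * ENNReal.ofReal (CK * σ ^ (-(1 / 2 : ℝ))) := by
            rw [hK₁eq]; gcongr
        _ = ENNReal.ofReal (K₁ * CK * H) := by
            rw [← ENNReal.ofReal_mul hK₁0, hHdef, mul_assoc]
    rcases le_total L H with hLH | hHL
    · rw [min_eq_left hLH]
      refine hlow.trans (ENNReal.ofReal_le_ofReal ?_)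
      exact mul_le_mul_of_nonneg_right (le_max_left _ _) hL0
    · rw [min_eq_right hHL]
      refine hhigh.trans (ENNReal.ofReal_le_ofReal ?_)
      exact mul_le_mul_of_nonneg_right (le_max_right _ _) hH0
  -- the norm of the double sum is the double sum of the norms
  have hpt : ∀ y, ‖∑ k, ∑ l, ‖blockFn j (fun w => oseenKernel σ w (e k) (e l)) y‖‖ₑ =
      ∑ k, ∑ l, ‖blockFn j (fun w => oseenKernel σ w (e k) (e l)) y‖ₑ := by
    intro y
    have h0 : ∀ k, 0 ≤ ∑ l, ‖blockFn j (fun w => oseenKernel σ w (e k) (e l)) y‖ := fun k =>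
      Finset.sum_nonneg fun l _ => norm_nonneg _
    rw [Real.enorm_eq_ofReal (Finset.sum_nonneg fun k _ => h0 k),
      ENNReal.ofReal_sum_of_nonneg fun k _ => h0 k]
    refine Finset.sum_congr rfl fun k _ => ?_
    rw [ENNReal.ofReal_sum_of_nonneg fun l _ => norm_nonneg _]
    exact Finset.sum_congr rfl fun l _ => ofReal_norm _
  calc ∫⁻ y, ‖∑ k, ∑ l, ‖blockFn j (fun w => oseenKernel σ w (e k) (e l)) y‖‖ₑ
      = ∫⁻ y, ∑ k, ∑ l, ‖blockFn j (fun w => oseenKernel σ w (e k) (e l)) y‖ₑ := lintegral_congr hpt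
    _ = ∑ k, ∫⁻ y, ∑ l, ‖blockFn j (fun w => oseenKernel σ w (e k) (e l)) y‖ₑ :=
        lintegral_finsetSum' _ fun k _ => Finset.aemeasurable_fun_sum _ fun l _ => (hm k l).enorm
    _ = ∑ k, ∑ l, ∫⁻ y, ‖blockFn j (fun w => oseenKernel σ w (e k) (e l)) y‖ₑ := by
        refine Finset.sum_congr rfl fun k _ => ?_
        exact lintegral_finsetSum' _ fun l _ => (hm k l).enorm
    _ ≤ ∑ k : Fin (Module.finrank ℝ E), ∑ l : Fin (Module.finrank ℝ E), ENNReal.ofReal (C₀ * min L H) :=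
        Finset.sum_le_sum fun k _ => Finset.sum_le_sum fun l _ => hterm k l
    _ = ENNReal.ofReal ((Module.finrank ℝ E) * (Module.finrank ℝ E) * C₀ * min L H) := by
        rw [Finset.sum_const, Finset.card_univ, Fintype.card_fin, Finset.sum_const,
          Finset.card_univ, Fintype.card_fin, nsmul_eq_mul, nsmul_eq_mul, ← mul_assoc,
          ← Nat.cast_mul, ← ENNReal.ofReal_natCast, ← ENNReal.ofReal_mul (Nat.cast_nonneg _),
          Nat.cast_mul, mul_assoc ((Module.finrank ℝ E : ℝ) * (Module.finrank ℝ E : ℝ))]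

end Majorant

/-! ### Time integrals -/

section TimeIntegrals

/-- `∫⁻_{(t₁,t)} ofReal (c (t - s)^{-e}) = ofReal (c (t-t₁)^{1-e}/(1-e))` for `e < 1`, `t₁ < t`,
`c ≥ 0`. [folklore] -/
theorem lintegral_Ioo_ofReal_mul_sub_rpow_neg {e : ℝ} (he : e < 1) {t₁ t c : ℝ} (ht : t₁ < t)
    (hc : 0 ≤ c) :
    ∫⁻ s in Ioo t₁ t, ENNReal.ofReal (c * (t - s) ^ (-e)) =
      ENNReal.ofReal (c * ((t - t₁) ^ (1 - e) / (1 - e))) := by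
  have he' : -1 < -e := by linarith
  have hh : 0 < t - t₁ := sub_pos.2 ht
  have hii : IntervalIntegrable (fun s : ℝ => (t - s) ^ (-e)) volume t₁ t := by
    have h := (intervalIntegral.intervalIntegrable_rpow' (a := 0) (b := t - t₁) he').comp_sub_left t
    rw [sub_zero, sub_sub_cancel] at h
    exact h.symm
  have hint : IntegrableOn (fun s : ℝ => c * (t - s) ^ (-e)) (Ioo t₁ t) volume := by
    have h := hii.const_mul c
    rw [intervalIntegrable_iff_integrableOn_Ioo_of_le ht.le] at h
    exact h
  have hnn : 0 ≤ᵐ[volume.restrict (Ioo t₁ t)] fun s : ℝ => c * (t - s) ^ (-e) :=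
    (ae_restrict_mem measurableSet_Ioo).mono fun s hs =>
      mul_nonneg hc (Real.rpow_nonneg (sub_pos.2 hs.2).le _)
  rw [← ofReal_integral_eq_lintegral_ofReal hint hnn, integral_const_mul]
  congr 2
  rw [← integral_Ioc_eq_integral_Ioo, ← intervalIntegral.integral_of_le ht.le,
    intervalIntegral.integral_comp_sub_left (fun s : ℝ => s ^ (-e)) t, sub_self,
    integral_rpow (Or.inl he'), Real.zero_rpow (by linarith), sub_zero]
  congr 1 <;> ring

end TimeIntegrals

/-! ### The block profile of the Duhamel term of a Kato-class field -/

section Profile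

variable {E : Type*} [NormedAddCommGroup E] [InnerProductSpace ℝ E] [FiniteDimensional ℝ E]
  [MeasurableSpace E] [BorelSpace E]

/-- The Kato weight of the tensor: `‖|u(s)||u(s)|‖_{L^p} ≤ ab s^{-(1-3/(2p))}` when
`‖u(s)‖_{L^p} ≤ a s^{-(1-3/p)/2}` and `|u(s)(x)| ≤ b s^{-1/2}`. [folklore] -/
theorem eLpNorm_norm_mul_norm_le_kato {p : ℝ≥0∞} {u : ℝ → E → E} (hum : Measurable (uncurry u))
    {a b s : ℝ} (hs : 0 < s) (hb : 0 ≤ b)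
    (hLp : eLpNorm (u s) p volume ≤ ENNReal.ofReal (a * s ^ (-((1 - 3 / p.toReal) / 2))))
    (hLi : ∀ x, ‖u s x‖ ≤ b * s ^ (-(1 / 2 : ℝ))) :
    eLpNorm (fun y => ‖u s y‖ * ‖u s y‖) p volume ≤
      ENNReal.ofReal (a * b * s ^ (-(1 - 3 / (2 * p.toReal)))) := by
  have hm : AEStronglyMeasurable (u s) volume := (measurable_slice hum s).aestronglyMeasurable
  calc eLpNorm (fun y => ‖u s y‖ * ‖u s y‖) p volume
      ≤ eLpNorm (u s) p volume * eLpNorm (u s) ∞ volume := eLpNorm_norm_mul_norm_le hm hm p ∞ p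
    _ ≤ ENNReal.ofReal (a * s ^ (-((1 - 3 / p.toReal) / 2))) *
          ENNReal.ofReal (b * s ^ (-(1 / 2 : ℝ))) :=
        mul_le_mul' hLp (eLpNorm_top_le_ofReal_of_norm_le hLi)
    _ = ENNReal.ofReal (a * b * s ^ (-(1 - 3 / (2 * p.toReal)))) := by
        rw [← ENNReal.ofReal_mul' (by positivity)]
        congr 1
        rw [mul_mul_mul_comm, KatoLp.rpow_neg_half_mul_neg_half hs]
        congr 2
        ring

/-- **The `ℓ¹ ∩ ℓ^∞` block profile of the Duhamel term** (BCD, proof of Thm. 5.40; GKP 2016,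
App. B): for `3 < p < ∞` there is `C` such that for every jointly measurable `u` with
`‖u(s)‖_{L^p} ≤ a s^{-(1-3/p)/2}` and `|u(s)(x)| ≤ b s^{-1/2}` on `(0, T)`, every `t ∈ (0,T)` and
`j ∈ ℤ`,
`2^{js_p} ‖Δ̇_j B(u,u)(t)‖_{L^p} ≤ C a b min(y^{3/(2p)}, y^{-(1-3/p)})`, `s_p = -1 + 3/p`,
`y = 2^j √t`: Kato's estimate on the blocks with the weight `ab s^{-(1-3/(2p))}`, the majorant bound
with `θ = 1 - 3/(2p)` at low frequency (`∫₀ᵗ (t-s)^{-3/(4p)} s^{-(1-3/(2p))} ds ∝ t^{3/(4p)}`)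
and the plain bound at high frequency (`∫₀ᵗ (t-s)^{-1/2} s^{-(1-3/(2p))} ds ∝ t^{-(1-3/p)/2}`).
[cite: GKP2016, App. B] -/
theorem exists_lpBlockWeight_kochTataruBilinear_le {p : ℝ≥0∞} (hp₃ : 3 < p) (hp : p < ∞) :
    ∃ C : ℝ, 0 ≤ C ∧ ∀ {u : ℝ → E → E} {T a b : ℝ}, Measurable (uncurry u) → 0 ≤ a → 0 ≤ b →
      (∀ t ∈ Ioo 0 T, eLpNorm (u t) p volume ≤
          ENNReal.ofReal (a * t ^ (-((1 - 3 / p.toReal) / 2)))) →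
      (∀ t ∈ Ioo 0 T, ∀ x, ‖u t x‖ ≤ b * t ^ (-(1 / 2 : ℝ))) →
      ∀ t ∈ Ioo 0 T, ∀ j : ℤ,
        (2 : ℝ≥0∞) ^ ((j : ℝ) * (-1 + 3 / p.toReal)) *
            eLpNorm (blockFn j (kochTataruBilinear u u t)) p volume ≤
          ENNReal.ofReal (C * a * b * min (((2 : ℝ) ^ j * Real.sqrt t) ^ (3 / (2 * p.toReal)))
            (((2 : ℝ) ^ j * Real.sqrt t) ^ (-(1 - 3 / p.toReal)))) := by
  -- exponents
  have hr3 := KatoLp.three_lt_toReal hp₃ hp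
  have hp1 : 1 ≤ p := (lt_trans (by norm_num) hp₃).le
  set r : ℝ := p.toReal with hr
  have hr0 : 0 < r := by linarith
  have h32 : 3 / (2 * r) < 1 / 2 := by
    rw [div_lt_div_iff₀ (by positivity) (by norm_num)]; linarith
  have h320 : 0 < 3 / (2 * r) := by positivity
  have h3r : 3 / r < 1 := by rw [div_lt_one hr0]; exact hr3
  set θ : ℝ := 1 - 3 / (2 * r) with hθ
  set γ : ℝ := 1 - 3 / (2 * r) with hγ
  set sp : ℝ := -1 + 3 / r with hsp
  have hθ0 : 0 ≤ θ := by rw [hθ]; linarith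
  have hθ1 : θ < 1 := by rw [hθ]; linarith
  have hγ0 : 0 ≤ γ := hθ0
  have hγ1 : γ < 1 := hθ1
  have ha₁0 : 0 ≤ (1 - θ) / 2 := by linarith
  have ha₁1 : (1 - θ) / 2 < 1 := by linarith
  obtain ⟨C₁, hC₁, hM⟩ := exists_lintegral_oseenKernelBlockMajorant_le (E := E) hθ0 hθ1
  set IL : ℝ := ∫ x in (0 : ℝ)..1, (1 - x) ^ (-((1 - θ) / 2)) * x ^ (-γ) with hIL
  set IH : ℝ := ∫ x in (0 : ℝ)..1, (1 - x) ^ (-(1 / 2 : ℝ)) * x ^ (-γ) with hIH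
  have hIL0 : 0 ≤ IL := integral_one_sub_rpow_mul_rpow_nonneg _ _
  have hIH0 : 0 ≤ IH := integral_one_sub_rpow_mul_rpow_nonneg _ _
  refine ⟨C₁ * max IL IH, by positivity, fun {u T a b} hum ha hb hLp hLi t ht j => ?_⟩
  have ht0 : 0 < t := ht.1
  -- the weight of the tensor
  set N : ℝ → ℝ := fun s => a * b * s ^ (-γ) with hN
  have hN0 : ∀ s ∈ Ioo 0 t, 0 ≤ N s := fun s hs => by
    rw [hN]; exact mul_nonneg (mul_nonneg ha hb) (Real.rpow_nonneg hs.1.le _)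
  have hNle : ∀ s ∈ Ioo 0 t, eLpNorm (fun y => ‖u s y‖ * ‖u s y‖) p volume ≤
      ENNReal.ofReal (N s) := by
    intro s hs
    have hsT : s ∈ Ioo 0 T := ⟨hs.1, hs.2.trans ht.2⟩
    have h := eLpNorm_norm_mul_norm_le_kato hum hs.1 hb (hLp s hsT) (hLi s hsT)
    rw [hN]
    exact h
  have hMu : ∀ s ∈ Ioo 0 t, ∀ y, ‖u s y‖ ≤ b * s ^ (-(1 / 2 : ℝ)) := fun s hs y =>
    hLi s ⟨hs.1, hs.2.trans ht.2⟩ y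
  have hNi : IntegrableOn (fun s => (t - s) ^ (-(1 / 2 : ℝ)) * N s) (Ioo 0 t) := by
    have h := (intervalIntegrable_sub_rpow_mul_rpow (a := 1 / 2) (b := γ) (by norm_num)
      (by norm_num) hγ0 hγ1 ht0).const_mul (a * b)
    rw [intervalIntegrable_iff_integrableOn_Ioo_of_le ht0.le] at h
    refine h.congr_fun (fun s _ => ?_) measurableSet_Ioo
    simp only [hN]
    ring
  have hblock := eLpNorm_blockFn_kochTataruBilinear_le j hum hum hMu hMu hp1 hp.ne hNle hN0 hNi
  -- the time integral, bounded in two ways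
  have hlow : (∫⁻ s in Ioo 0 t, (∫⁻ y, ‖∑ k, ∑ l, ‖blockFn j (fun w => oseenKernel (t - s) w
      (stdOrthonormalBasis ℝ E k) (stdOrthonormalBasis ℝ E l)) y‖‖ₑ) * ENNReal.ofReal (N s)) ≤
      ENNReal.ofReal (C₁ * (2 : ℝ) ^ ((j : ℝ) * θ) * (a * b) *
        (t ^ (1 - (1 - θ) / 2 - γ) * IL)) := by
    calc _ ≤ ∫⁻ s in Ioo 0 t, ENNReal.ofReal (C₁ * (2 : ℝ) ^ ((j : ℝ) * θ) * (a * b) *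
          ((t - s) ^ (-((1 - θ) / 2)) * s ^ (-γ))) := by
          refine setLIntegral_mono' measurableSet_Ioo fun s hs => ?_
          have hσ : 0 < t - s := sub_pos.2 hs.2
          have hs0 : 0 < s := hs.1
          have h1 : (∫⁻ y, ‖∑ k, ∑ l, ‖blockFn j (fun w => oseenKernel (t - s) w
              (stdOrthonormalBasis ℝ E k) (stdOrthonormalBasis ℝ E l)) y‖‖ₑ) ≤
              ENNReal.ofReal (C₁ * ((2 : ℝ) ^ ((j : ℝ) * θ) * (t - s) ^ ((θ - 1) / 2))) :=
            (hM j hσ).trans (ENNReal.ofReal_le_ofReal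
              (mul_le_mul_of_nonneg_left (min_le_left _ _) hC₁))
          calc _ ≤ ENNReal.ofReal (C₁ * ((2 : ℝ) ^ ((j : ℝ) * θ) * (t - s) ^ ((θ - 1) / 2))) *
                ENNReal.ofReal (N s) := mul_le_mul' h1 le_rfl
            _ = _ := by
                rw [← ENNReal.ofReal_mul (by positivity), hN]
                congr 1
                have hexp : (t - s) ^ ((θ - 1) / 2) = (t - s) ^ (-((1 - θ) / 2)) := by
                  congr 1; ring
                rw [hexp]
                ring
      _ = _ := lintegral_Ioo_ofReal_sub_rpow_mul_rpow ha₁0 ha₁1 hγ0 hγ1 (by positivity) ht0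
  have hhigh : (∫⁻ s in Ioo 0 t, (∫⁻ y, ‖∑ k, ∑ l, ‖blockFn j (fun w => oseenKernel (t - s) w
      (stdOrthonormalBasis ℝ E k) (stdOrthonormalBasis ℝ E l)) y‖‖ₑ) * ENNReal.ofReal (N s)) ≤
      ENNReal.ofReal (C₁ * (a * b) * (t ^ (1 - 1 / 2 - γ) * IH)) := by
    calc _ ≤ ∫⁻ s in Ioo 0 t, ENNReal.ofReal (C₁ * (a * b) *
          ((t - s) ^ (-(1 / 2 : ℝ)) * s ^ (-γ))) := by
          refine setLIntegral_mono' measurableSet_Ioo fun s hs => ?_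
          have hσ : 0 < t - s := sub_pos.2 hs.2
          have hs0 : 0 < s := hs.1
          have h1 : (∫⁻ y, ‖∑ k, ∑ l, ‖blockFn j (fun w => oseenKernel (t - s) w
              (stdOrthonormalBasis ℝ E k) (stdOrthonormalBasis ℝ E l)) y‖‖ₑ) ≤
              ENNReal.ofReal (C₁ * (t - s) ^ (-(1 / 2 : ℝ))) :=
            (hM j hσ).trans (ENNReal.ofReal_le_ofReal
              (mul_le_mul_of_nonneg_left (min_le_right _ _) hC₁))
          calc _ ≤ ENNReal.ofReal (C₁ * (t - s) ^ (-(1 / 2 : ℝ))) * ENNReal.ofReal (N s) :=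
                mul_le_mul' h1 le_rfl
            _ = _ := by
                rw [← ENNReal.ofReal_mul (by positivity), hN]
                congr 1
                ring
      _ = _ := lintegral_Ioo_ofReal_sub_rpow_mul_rpow (by norm_num) (by norm_num) hγ0 hγ1
          (by positivity) ht0
  -- multiply by the Besov weight and identify the profile
  set y : ℝ := (2 : ℝ) ^ j * Real.sqrt t with hy
  have hy0 : 0 ≤ y := by positivity
  have hW : (2 : ℝ≥0∞) ^ ((j : ℝ) * (-1 + 3 / p.toReal)) = ENNReal.ofReal ((2 : ℝ) ^ ((j : ℝ) * sp)) := by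
    rw [ofReal_two_rpow]
  have hexpL : (2 : ℝ) ^ ((j : ℝ) * sp) * ((2 : ℝ) ^ ((j : ℝ) * θ) * t ^ (1 - (1 - θ) / 2 - γ)) =
      y ^ (3 / (2 * r)) := by
    have h1 : (2 : ℝ) ^ ((j : ℝ) * sp) * (2 : ℝ) ^ ((j : ℝ) * θ) = (2 : ℝ) ^ ((j : ℝ) * (3 / (2 * r))) := by
      rw [← Real.rpow_add two_pos]
      congr 1
      rw [hsp, hθ]
      ring
    have h2 : 1 - (1 - θ) / 2 - γ = (3 / (2 * r)) / 2 := by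
      rw [hθ, hγ]; ring
    rw [← mul_assoc, h1, h2, hy]
    exact two_rpow_mul_rpow_half ht0.le j _
  have hexpH : (2 : ℝ) ^ ((j : ℝ) * sp) * t ^ (1 - 1 / 2 - γ) = y ^ (-(1 - 3 / r)) := by
    have h2 : (1 : ℝ) - 1 / 2 - γ = (-(1 - 3 / r)) / 2 := by
      rw [hγ]; ring
    have h3 : sp = -(1 - 3 / r) := by rw [hsp]; ring
    rw [h2, h3, hy]
    exact two_rpow_mul_rpow_half ht0.le j _
  have hLtot : (2 : ℝ≥0∞) ^ ((j : ℝ) * (-1 + 3 / p.toReal)) *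
      eLpNorm (blockFn j (kochTataruBilinear u u t)) p volume ≤
      ENNReal.ofReal (C₁ * IL * (a * b) * y ^ (3 / (2 * r))) := by
    rw [hW]
    calc _ ≤ ENNReal.ofReal ((2 : ℝ) ^ ((j : ℝ) * sp)) * ENNReal.ofReal (C₁ * (2 : ℝ) ^ ((j : ℝ) * θ) *
          (a * b) * (t ^ (1 - (1 - θ) / 2 - γ) * IL)) := mul_le_mul' le_rfl (hblock.trans hlow)
      _ = _ := by
          rw [← ENNReal.ofReal_mul (Real.rpow_nonneg zero_le_two _), ← hexpL]
          congr 1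
          ring
  have hHtot : (2 : ℝ≥0∞) ^ ((j : ℝ) * (-1 + 3 / p.toReal)) *
      eLpNorm (blockFn j (kochTataruBilinear u u t)) p volume ≤
      ENNReal.ofReal (C₁ * IH * (a * b) * y ^ (-(1 - 3 / r))) := by
    rw [hW]
    calc _ ≤ ENNReal.ofReal ((2 : ℝ) ^ ((j : ℝ) * sp)) * ENNReal.ofReal (C₁ * (a * b) *
          (t ^ (1 - 1 / 2 - γ) * IH)) := mul_le_mul' le_rfl (hblock.trans hhigh)
      _ = _ := by
          rw [← ENNReal.ofReal_mul (Real.rpow_nonneg zero_le_two _), ← hexpH]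
          congr 1
          ring
  -- conclusion
  have hyL : 0 ≤ y ^ (3 / (2 * r)) := Real.rpow_nonneg hy0 _
  have hyH : 0 ≤ y ^ (-(1 - 3 / r)) := Real.rpow_nonneg hy0 _
  have hkey : min (C₁ * IL * (a * b) * y ^ (3 / (2 * r))) (C₁ * IH * (a * b) * y ^ (-(1 - 3 / r))) ≤
      C₁ * max IL IH * a * b * min (y ^ (3 / (2 * r))) (y ^ (-(1 - 3 / r))) := by
    have h := min_mul_mul_le_max_mul_min (c₁ := C₁ * IL * (a * b)) (c₂ := C₁ * IH * (a * b)) hyL hyH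
    refine h.trans (le_of_eq ?_)
    have hmax : max (C₁ * IL * (a * b)) (C₁ * IH * (a * b)) = C₁ * max IL IH * a * b := by
      rw [show C₁ * IL * (a * b) = IL * (C₁ * (a * b)) by ring,
        show C₁ * IH * (a * b) = IH * (C₁ * (a * b)) by ring, ← max_mul_of_nonneg _ _ (by positivity)]
      ring
    rw [hmax]
  rcases le_total (C₁ * IL * (a * b) * y ^ (3 / (2 * r))) (C₁ * IH * (a * b) * y ^ (-(1 - 3 / r)))
    with h | h
  · rw [min_eq_left h] at hkey
    exact hLtot.trans (ENNReal.ofReal_le_ofReal hkey)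
  · rw [min_eq_right h] at hkey
    exact hHtot.trans (ENNReal.ofReal_le_ofReal hkey)

/-- **The block profile of the short Duhamel pieces** `B¹_{t₁}(u,u)(t) = ∫_{t₁}^t e^{(t-s)Δ}ℙ∇·(u⊗u)(s) ds`
(`oseenDuhamel 1 t₁ u u t`; GKP 2016, App. B): for `3 < p < ∞` there is `C` such that, for `u` in
Kato's class with constants `(a, b)` on `(0, T)` and `0 < t₁ < t ≤ T`, `h = t - t₁`, `z = 2^j √h`,
`γ = 1 - 3/(2p)`:
`2^{js_p} ‖Δ̇_j B¹_{t₁}(u,u)(t)‖_{L^p} ≤ C a b t₁^{-γ} h^{γ} min(z^{3/(2p)}, z^{-(1-3/p)})`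
(on `(t₁, t)` the tensor weight is `≤ ab t₁^{-γ}`; `∫_{t₁}^t (t-s)^{-3/(4p)} ds ∝ h^{1-3/(4p)}`,
`∫_{t₁}^t (t-s)^{-1/2} ds = 2h^{1/2}`). [cite: GKP2016, App. B] -/
theorem exists_lpBlockWeight_oseenDuhamel_one_le {p : ℝ≥0∞} (hp₃ : 3 < p) (hp : p < ∞) :
    ∃ C : ℝ, 0 ≤ C ∧ ∀ {u : ℝ → E → E} {T a b : ℝ}, Measurable (uncurry u) → 0 ≤ a → 0 ≤ b →
      (∀ t ∈ Ioo 0 T, eLpNorm (u t) p volume ≤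
          ENNReal.ofReal (a * t ^ (-((1 - 3 / p.toReal) / 2)))) →
      (∀ t ∈ Ioo 0 T, ∀ x, ‖u t x‖ ≤ b * t ^ (-(1 / 2 : ℝ))) →
      ∀ {t₁ t : ℝ}, 0 < t₁ → t₁ < t → t ≤ T → ∀ j : ℤ,
        (2 : ℝ≥0∞) ^ ((j : ℝ) * (-1 + 3 / p.toReal)) *
            eLpNorm (blockFn j (oseenDuhamel 1 t₁ u u t)) p volume ≤
          ENNReal.ofReal (C * a * b * t₁ ^ (-(1 - 3 / (2 * p.toReal))) *
            (t - t₁) ^ (1 - 3 / (2 * p.toReal)) *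
            min (((2 : ℝ) ^ j * Real.sqrt (t - t₁)) ^ (3 / (2 * p.toReal)))
              (((2 : ℝ) ^ j * Real.sqrt (t - t₁)) ^ (-(1 - 3 / p.toReal)))) := by
  -- exponents
  have hr3 := KatoLp.three_lt_toReal hp₃ hp
  have hp1 : 1 ≤ p := (lt_trans (by norm_num) hp₃).le
  set r : ℝ := p.toReal with hr
  have hr0 : 0 < r := by linarith
  have h32 : 3 / (2 * r) < 1 / 2 := by
    rw [div_lt_div_iff₀ (by positivity) (by norm_num)]; linarith
  have h320 : 0 < 3 / (2 * r) := by positivity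
  have h3r : 3 / r < 1 := by rw [div_lt_one hr0]; exact hr3
  set θ : ℝ := 1 - 3 / (2 * r) with hθ
  set γ : ℝ := 1 - 3 / (2 * r) with hγ
  set sp : ℝ := -1 + 3 / r with hsp
  have hθ0 : 0 ≤ θ := by rw [hθ]; linarith
  have hθ1 : θ < 1 := by rw [hθ]; linarith
  have hγ0 : 0 ≤ γ := hθ0
  have ha₁1 : (1 - θ) / 2 < 1 := by linarith
  obtain ⟨C₁, hC₁, hM⟩ := exists_lintegral_oseenKernelBlockMajorant_le (E := E) hθ0 hθ1
  set cL : ℝ := 1 / (1 - (1 - θ) / 2) with hcL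
  set cH : ℝ := 1 / (1 - 1 / 2 : ℝ) with hcH
  have hcL0 : 0 ≤ cL := by rw [hcL]; exact div_nonneg zero_le_one (by linarith)
  have hcH0 : 0 ≤ cH := by rw [hcH]; norm_num
  refine ⟨C₁ * max cL cH, by positivity, fun {u T a b} hum ha hb hLp hLi {t₁ t} ht₁ ht₁t htT j => ?_⟩
  have hh : 0 < t - t₁ := sub_pos.2 ht₁t
  -- the (constant) weight of the tensor on `(t₁, t)`
  set N₀ : ℝ := a * b * t₁ ^ (-γ) with hN₀
  have hN₀0 : 0 ≤ N₀ := mul_nonneg (mul_nonneg ha hb) (Real.rpow_nonneg ht₁.le _)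
  have hNle : ∀ s ∈ Ioo t₁ t, eLpNorm (fun y => ‖u s y‖ * ‖u s y‖) p volume ≤
      ENNReal.ofReal ((fun _ => N₀) s) := by
    intro s hs
    have hs0 : 0 < s := ht₁.trans hs.1
    have hsT : s ∈ Ioo 0 T := ⟨hs0, hs.2.trans_le htT⟩
    refine (eLpNorm_norm_mul_norm_le_kato hum hs0 hb (hLp s hsT) (hLi s hsT)).trans
      (ENNReal.ofReal_le_ofReal ?_)
    rw [hN₀, hγ]
    refine mul_le_mul_of_nonneg_left ?_ (mul_nonneg ha hb)
    exact Real.rpow_le_rpow_of_nonpos ht₁ hs.1.le (by linarith)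
  have hMu : ∀ s ∈ Ioo t₁ t, ∀ y, ‖u s y‖ ≤ b * s ^ (-(1 / 2 : ℝ)) := fun s hs y =>
    hLi s ⟨ht₁.trans hs.1, hs.2.trans_le htT⟩ y
  have hNi : IntegrableOn (fun s => (t - s) ^ (-(1 / 2 : ℝ)) * (fun _ => N₀) s) (Ioo t₁ t) := by
    have h := ((intervalIntegral.intervalIntegrable_rpow' (a := 0) (b := t - t₁) (r := -(1 / 2 : ℝ))
      (by norm_num)).comp_sub_left t).symm
    rw [sub_zero, sub_sub_cancel] at h
    have h' := h.mul_const N₀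
    rw [intervalIntegrable_iff_integrableOn_Ioo_of_le ht₁t.le] at h'
    exact h'
  have hblock := eLpNorm_blockFn_oseenDuhamel_one_le j hum hum hMu hMu hp1 hp.ne hNle
    (fun s _ => hN₀0) hNi
  -- the time integral, bounded in two ways
  have hlow : (∫⁻ s in Ioo t₁ t, (∫⁻ y, ‖∑ k, ∑ l, ‖blockFn j (fun w => oseenKernel (t - s) w
      (stdOrthonormalBasis ℝ E k) (stdOrthonormalBasis ℝ E l)) y‖‖ₑ) * ENNReal.ofReal N₀) ≤
      ENNReal.ofReal (C₁ * (2 : ℝ) ^ ((j : ℝ) * θ) * N₀ *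
        ((t - t₁) ^ (1 - (1 - θ) / 2) / (1 - (1 - θ) / 2))) := by
    calc _ ≤ ∫⁻ s in Ioo t₁ t, ENNReal.ofReal (C₁ * (2 : ℝ) ^ ((j : ℝ) * θ) * N₀ *
          (t - s) ^ (-((1 - θ) / 2))) := by
          refine setLIntegral_mono' measurableSet_Ioo fun s hs => ?_
          have hσ : 0 < t - s := sub_pos.2 hs.2
          have h1 : (∫⁻ y, ‖∑ k, ∑ l, ‖blockFn j (fun w => oseenKernel (t - s) w
              (stdOrthonormalBasis ℝ E k) (stdOrthonormalBasis ℝ E l)) y‖‖ₑ) ≤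
              ENNReal.ofReal (C₁ * ((2 : ℝ) ^ ((j : ℝ) * θ) * (t - s) ^ ((θ - 1) / 2))) :=
            (hM j hσ).trans (ENNReal.ofReal_le_ofReal
              (mul_le_mul_of_nonneg_left (min_le_left _ _) hC₁))
          calc _ ≤ ENNReal.ofReal (C₁ * ((2 : ℝ) ^ ((j : ℝ) * θ) * (t - s) ^ ((θ - 1) / 2))) *
                ENNReal.ofReal N₀ := mul_le_mul' h1 le_rfl
            _ = _ := by
                rw [← ENNReal.ofReal_mul (by positivity)]
                congr 1
                have hexp : (t - s) ^ ((θ - 1) / 2) = (t - s) ^ (-((1 - θ) / 2)) := by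
                  congr 1; ring
                rw [hexp]
                ring
      _ = _ := lintegral_Ioo_ofReal_mul_sub_rpow_neg ha₁1 ht₁t (by positivity)
  have hhigh : (∫⁻ s in Ioo t₁ t, (∫⁻ y, ‖∑ k, ∑ l, ‖blockFn j (fun w => oseenKernel (t - s) w
      (stdOrthonormalBasis ℝ E k) (stdOrthonormalBasis ℝ E l)) y‖‖ₑ) * ENNReal.ofReal N₀) ≤
      ENNReal.ofReal (C₁ * N₀ * ((t - t₁) ^ (1 - 1 / 2 : ℝ) / (1 - 1 / 2 : ℝ))) := by
    calc _ ≤ ∫⁻ s in Ioo t₁ t, ENNReal.ofReal (C₁ * N₀ * (t - s) ^ (-(1 / 2 : ℝ))) := by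
          refine setLIntegral_mono' measurableSet_Ioo fun s hs => ?_
          have hσ : 0 < t - s := sub_pos.2 hs.2
          have h1 : (∫⁻ y, ‖∑ k, ∑ l, ‖blockFn j (fun w => oseenKernel (t - s) w
              (stdOrthonormalBasis ℝ E k) (stdOrthonormalBasis ℝ E l)) y‖‖ₑ) ≤
              ENNReal.ofReal (C₁ * (t - s) ^ (-(1 / 2 : ℝ))) :=
            (hM j hσ).trans (ENNReal.ofReal_le_ofReal
              (mul_le_mul_of_nonneg_left (min_le_right _ _) hC₁))
          calc _ ≤ ENNReal.ofReal (C₁ * (t - s) ^ (-(1 / 2 : ℝ))) * ENNReal.ofReal N₀ :=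
                mul_le_mul' h1 le_rfl
            _ = _ := by
                rw [← ENNReal.ofReal_mul (by positivity)]
                congr 1
                ring
      _ = _ := lintegral_Ioo_ofReal_mul_sub_rpow_neg (by norm_num) ht₁t (by positivity)
  -- multiply by the Besov weight and identify the profile
  set z : ℝ := (2 : ℝ) ^ j * Real.sqrt (t - t₁) with hz
  have hz0 : 0 ≤ z := by positivity
  have hW : (2 : ℝ≥0∞) ^ ((j : ℝ) * (-1 + 3 / p.toReal)) = ENNReal.ofReal ((2 : ℝ) ^ ((j : ℝ) * sp)) := by
    rw [ofReal_two_rpow]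
  have hexpL : (2 : ℝ) ^ ((j : ℝ) * sp) * ((2 : ℝ) ^ ((j : ℝ) * θ) * (t - t₁) ^ (1 - (1 - θ) / 2)) =
      (t - t₁) ^ γ * z ^ (3 / (2 * r)) := by
    have h1 : (2 : ℝ) ^ ((j : ℝ) * sp) * (2 : ℝ) ^ ((j : ℝ) * θ) = (2 : ℝ) ^ ((j : ℝ) * (3 / (2 * r))) := by
      rw [← Real.rpow_add two_pos]
      congr 1
      rw [hsp, hθ]
      ring
    have h2 : (t - t₁) ^ (1 - (1 - θ) / 2) = (t - t₁) ^ γ * (t - t₁) ^ ((3 / (2 * r)) / 2) := by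
      rw [← Real.rpow_add hh]
      congr 1
      rw [hθ, hγ]; ring
    rw [← mul_assoc, h1, h2, mul_left_comm, hz, two_rpow_mul_rpow_half hh.le j _]
  have hexpH : (2 : ℝ) ^ ((j : ℝ) * sp) * (t - t₁) ^ (1 - 1 / 2 : ℝ) =
      (t - t₁) ^ γ * z ^ (-(1 - 3 / r)) := by
    have h2 : (t - t₁) ^ (1 - 1 / 2 : ℝ) = (t - t₁) ^ γ * (t - t₁) ^ ((-(1 - 3 / r)) / 2) := by
      rw [← Real.rpow_add hh]
      congr 1
      rw [hγ]; ring
    have h3 : sp = -(1 - 3 / r) := by rw [hsp]; ring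
    rw [h2, mul_left_comm, h3, hz, two_rpow_mul_rpow_half hh.le j _]
  have hLtot : (2 : ℝ≥0∞) ^ ((j : ℝ) * (-1 + 3 / p.toReal)) *
      eLpNorm (blockFn j (oseenDuhamel 1 t₁ u u t)) p volume ≤
      ENNReal.ofReal (C₁ * cL * N₀ * (t - t₁) ^ γ * z ^ (3 / (2 * r))) := by
    rw [hW]
    calc _ ≤ ENNReal.ofReal ((2 : ℝ) ^ ((j : ℝ) * sp)) * ENNReal.ofReal (C₁ * (2 : ℝ) ^ ((j : ℝ) * θ) *
          N₀ * ((t - t₁) ^ (1 - (1 - θ) / 2) / (1 - (1 - θ) / 2))) :=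
          mul_le_mul' le_rfl (hblock.trans hlow)
      _ = _ := by
          rw [← ENNReal.ofReal_mul (Real.rpow_nonneg zero_le_two _)]
          congr 1
          rw [div_eq_mul_one_div, ← hcL]
          calc (2 : ℝ) ^ ((j : ℝ) * sp) * (C₁ * (2 : ℝ) ^ ((j : ℝ) * θ) * N₀ *
                ((t - t₁) ^ (1 - (1 - θ) / 2) * cL))
              = C₁ * cL * N₀ * ((2 : ℝ) ^ ((j : ℝ) * sp) *
                  ((2 : ℝ) ^ ((j : ℝ) * θ) * (t - t₁) ^ (1 - (1 - θ) / 2))) := by ring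
            _ = _ := by rw [hexpL]; ring
  have hHtot : (2 : ℝ≥0∞) ^ ((j : ℝ) * (-1 + 3 / p.toReal)) *
      eLpNorm (blockFn j (oseenDuhamel 1 t₁ u u t)) p volume ≤
      ENNReal.ofReal (C₁ * cH * N₀ * (t - t₁) ^ γ * z ^ (-(1 - 3 / r))) := by
    rw [hW]
    calc _ ≤ ENNReal.ofReal ((2 : ℝ) ^ ((j : ℝ) * sp)) * ENNReal.ofReal (C₁ * N₀ *
          ((t - t₁) ^ (1 - 1 / 2 : ℝ) / (1 - 1 / 2 : ℝ))) := mul_le_mul' le_rfl (hblock.trans hhigh)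
      _ = _ := by
          rw [← ENNReal.ofReal_mul (Real.rpow_nonneg zero_le_two _)]
          congr 1
          rw [div_eq_mul_one_div, ← hcH]
          calc (2 : ℝ) ^ ((j : ℝ) * sp) * (C₁ * N₀ * ((t - t₁) ^ (1 - 1 / 2 : ℝ) * cH))
              = C₁ * cH * N₀ * ((2 : ℝ) ^ ((j : ℝ) * sp) * (t - t₁) ^ (1 - 1 / 2 : ℝ)) := by ring
            _ = _ := by rw [hexpH]; ring
  -- conclusion
  have hzL : 0 ≤ z ^ (3 / (2 * r)) := Real.rpow_nonneg hz0 _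
  have hzH : 0 ≤ z ^ (-(1 - 3 / r)) := Real.rpow_nonneg hz0 _
  have hhγ : 0 ≤ (t - t₁) ^ γ := Real.rpow_nonneg hh.le _
  have hkey : min (C₁ * cL * N₀ * (t - t₁) ^ γ * z ^ (3 / (2 * r)))
      (C₁ * cH * N₀ * (t - t₁) ^ γ * z ^ (-(1 - 3 / r))) ≤
      C₁ * max cL cH * a * b * t₁ ^ (-γ) * (t - t₁) ^ γ * min (z ^ (3 / (2 * r))) (z ^ (-(1 - 3 / r))) := by
    have h := min_mul_mul_le_max_mul_min (c₁ := C₁ * cL * N₀ * (t - t₁) ^ γ)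
      (c₂ := C₁ * cH * N₀ * (t - t₁) ^ γ) hzL hzH
    refine h.trans (le_of_eq ?_)
    have hmax : max (C₁ * cL * N₀ * (t - t₁) ^ γ) (C₁ * cH * N₀ * (t - t₁) ^ γ) =
        C₁ * max cL cH * a * b * t₁ ^ (-γ) * (t - t₁) ^ γ := by
      rw [show C₁ * cL * N₀ * (t - t₁) ^ γ = cL * (C₁ * N₀ * (t - t₁) ^ γ) by ring,
        show C₁ * cH * N₀ * (t - t₁) ^ γ = cH * (C₁ * N₀ * (t - t₁) ^ γ) by ring,
        ← max_mul_of_nonneg _ _ (by positivity), hN₀]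
      ring
    rw [hmax]
  rcases le_total (C₁ * cL * N₀ * (t - t₁) ^ γ * z ^ (3 / (2 * r)))
    (C₁ * cH * N₀ * (t - t₁) ^ γ * z ^ (-(1 - 3 / r))) with h | h
  · rw [min_eq_left h] at hkey
    exact hLtot.trans (ENNReal.ofReal_le_ofReal hkey)
  · rw [min_eq_right h] at hkey
    exact hHtot.trans (ENNReal.ofReal_le_ofReal hkey)

end Profile

end Literature.Analysis.FluidPDE

end
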